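import Summits.BirchSwinnertonDyer.Rank1Residual.JET.McCallumProp44ByName
import Summits.BirchSwinnertonDyer.BirchSwinnertonDyer.Theorems.Rank1ResidualJetSwapStep
import HarnessLib

/-!
# T1 JET road K WITHOUT the `p`-adic tower — part 2: McCallum 1991 Prop. 4.4 «in particular» (`h44`/`h47`)
# under `ρ̄_{E,p}` onto ONLY (width seat `bsd-wall-soed-p2-w2` g5; `--supports`, helper)

Series note: see `Rank1ResidualJetModPCebotarev` (part 1). THIS FILE: `prop44_of_frobeniusCongruence_modP` — the
text of the Literature fact `McCallum1991.prop44_localOrder_kolyvaginClass_mul_eq` with its tower binder replaced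
by `W.HasSurjectiveModNGaloisRep p`, DERIVED from the image-free congruence (γ) =
`GrossLMS1991.prop37_2_frobeniusCongruence` exactly as `JET.prop44_of_frobeniusCongruence` (whose only image input
is `htower 1`); `addOrderOf_localization_kolyvaginClass_mul_eq_of_prop44_modP` — Jetchev's Prop. 4.7 (`h47`) in the
localisation currency (= `JET.addOrderOf_localization_kolyvaginClass_mul_eq_of_prop44` re-keyed from `h44` to (γ),
tower dropped); `Swap.addOrderOf_localization_kolyvaginClass_eq_of_prop44_cast_modP` — the cast form used by the
swap walk. HONEST FRAMING: theorems only (CONDITIONAL on (γ), a published fact); no new definition, no `sorry`;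
BSD is not proved by this file.
References: [cite: McCallumLMS1991, §4 Prop. 4.4 «In particular» (p. 301)] [cite: GrossLMS1991, Prop. 3.6,
Prop. 3.7 (2), Lemma 4.3] [cite: Nekovar2007, Prop. 4.9, Prop. 4.13 (ii)] [cite: Jetchev2008, Prop. 4.4 (p. 821)].
-/

set_option autoImplicit false

noncomputable section

open scoped Classical

open WeierstrassCurve IsDedekindDomain NumberField Field Literature.NumberTheory.EllipticCurves
  Literature.NumberTheory.EllipticCurves.ModularForms Literature.NumberTheory.EllipticCurves.Jetchev2008
  Literature.NumberTheory.EllipticCurves.KolyvaginCocycle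
  Literature.NumberTheory.GaloisRepresentations Literature.NumberTheory.GaloisCohomology
  Literature.NumberTheory.GaloisRepresentations.DiscreteGaloisModule
  Summit.BirchSwinnertonDyer.Rank1Residual.X11b Summit.BirchSwinnertonDyer.Rank1Residual.X11b.Three
  Summit.BirchSwinnertonDyer.Rank1Residual.JET.SelmerVocabulary Literature.NumberTheory.Automorphic
  Summit.BirchSwinnertonDyer.BirchSwinnertonDyer.Theorems

namespace Summit.BirchSwinnertonDyer.Rank1Residual.JET

section Prop44

-- `K : Type`: the tree's ring-class class field theory is universe `0`.
variable {K : Type} [Field K] [NumberField K] {W : WeierstrassCurve ℚ}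

/-- (γ) for a pair `(n, a)` with `a = n/ℓ` GIVEN AS AN EQUATION (so that it applies to `(mℓ, m)` through
`mℓ/ℓ = m`): `GrossLMS1991.prop37_2_frobeniusCongruence.reductionCongruence` transported along the
equation of levels. [cite: GrossLMS1991, Prop. 3.7 (2)] [cite: Nekovar2007, Prop. 4.9, Prop. 4.13 (ii)] -/
private theorem reductionCongruence_of_eq (h : GrossLMS1991.prop37_2_frobeniusCongruence)
    [W.IsElliptic] [W.IsGloballyMinimal] [NeZero (W.conductorNorm ℤ)] (hK : IsImaginaryQuadratic K)
    (hD : NumberField.discr K ≠ -3 ∧ NumberField.discr K ≠ -4)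
    (hH : SatisfiesHeegnerHypothesis (W.conductorNorm ℤ) K)
    {Dt : ModularParametrizationData W (W.conductorNorm ℤ)} {β : ℤ} {ι : K →+* ℂ}
    {n : ℕ} (hsq : Squarefree n) (hcop : Nat.Coprime n (W.conductorNorm ℤ)) {ℓ : ℕ}
    (hℓ : ℓ ∈ n.primeFactors) [Fact ℓ.Prime]
    (hℓ2 : ℓ ≠ 2 ∨ (¬ W.HasCM ∧ ∃ p : ℕ, p.Prime ∧ p ≠ 2 ∧ W.HasSurjectiveModNGaloisRep p ∧
      ∀ q ∈ n.primeFactors,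
        Literature.NumberTheory.EllipticCurves.IsKolyvaginPrime (W.conductorNorm ℤ) W K p q))
    (hinert : (Ideal.span {(ℓ : 𝓞 K)}).IsPrime) {a : ℕ} (e : a = n / ℓ)
    (dn : KolyvaginHeegnerData Dt β ι n) (da : KolyvaginHeegnerData Dt β ι a)
    (hΔ : ¬ (ℓ : ℤ) ∣ minimalDiscriminantInt W) {φ₀ : Field.absoluteGaloisGroup (ZMod ℓ)}
    (hφ₀ : ∀ x : AlgebraicClosure (ZMod ℓ), φ₀ • x = x ^ ℓ)
    (hle : ringClassField K ι a ≤ ringClassField K ι n)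
    (γ : ringClassField K ι n ≃ₐ[ℚ] ringClassField K ι n) :
    geomReduction hΔ ((RatClosure.pointsEquiv (K := K) W).symm
        (dn.toGeomPoints (pointGalHom W (ringClassField K ι n) γ dn.y))) =
      φ₀ • geomReduction hΔ ((RatClosure.pointsEquiv (K := K) W).symm
        (dn.toGeomPoints (pointGalHom W (ringClassField K ι n) γ
          (WeierstrassCurve.Affine.Point.map (W' := W)
            ((RingClassField.inclusion ι hle).restrictScalars ℚ) da.y)))) := by
  subst e
  exact h.reductionCongruence rfl hK hD hH hsq hcop hℓ hℓ2 hinert dn da hΔ hφ₀ hle γ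

/-- **McCallum 1991 Prop. 4.4 «in particular» — the typed print fact `h44` of the road-K END FORMS —
DERIVED from the image-free congruence (γ) = `GrossLMS1991.prop37_2_frobeniusCongruence`.** The body
at each `(W, K, p)` is `bsd-stepL`'s kernel theorem `Prop44.localOrder_kolyvaginClass_mul_eq_of_congruence`;
under the fact's own binders (`ρ̄_{E,p^n}` onto, `¬CM`, `d_K ∉ {−3,−4}`, Heegner, `p` odd, Zhang–Kolyvagin
levels) its three per-pair inputs are tree theorems: (γ) from the Literature fact (Zhang–Kolyvagin primes
are Gross–Kolyvagin primes under surjectivity, `ZhangGross.forall_isKolyvaginPrime_of_zhang`, which serves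
the fact's `ℓ = 2` escape clause), admissibility from `isAdmissible_pointsSubgroup`, invariance of `[P(·)]`
from `KolyCert.toGeomPoints_derivedPoint_mem_invPoints_of_dvd_zhang`.
[cite: McCallumLMS1991, §4 Prop. 4.4 «In particular» (p. 301), (4)–(5)] [cite: GrossLMS1991, Prop. 3.6,
Prop. 3.7 (2), Lemma 4.3] [cite: Nekovar2007, Prop. 4.9, Prop. 4.13 (ii)] -/
theorem prop44_of_frobeniusCongruence_modP (h372 : GrossLMS1991.prop37_2_frobeniusCongruence) :
    ∀ (W : WeierstrassCurve ℚ) [W.IsElliptic] [W.IsGloballyMinimal] [NeZero (W.conductorNorm ℤ)],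
    ¬ W.HasCM →
    ∀ (K : Type) [Field K] [NumberField K], IsImaginaryQuadratic K →
    NumberField.discr K ≠ -3 → NumberField.discr K ≠ -4 →
    SatisfiesHeegnerHypothesis (W.conductorNorm ℤ) K →
    ∀ (p : ℕ) [Fact p.Prime], p ≠ 2 → W.HasSurjectiveModNGaloisRep p →
    ∀ (Dt : ModularParametrizationData W (W.conductorNorm ℤ)) (β : ℤ) (ι : K →+* ℂ)
      (M : ℕ), 1 ≤ M →
    ∀ (m l : ℕ), Squarefree (m * l) → l.Prime → ¬ l ∣ m →
      (∀ l' ∈ (m * l).primeFactors, Zhang2014.IsKolyvaginPrime (W.conductorNorm ℤ) W K p l' ∧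
        M ≤ Zhang2014.kolyvaginIndex W p l') →
    ∀ (d : KolyvaginHeegnerData Dt β ι m) (d' : KolyvaginHeegnerData Dt β ι (m * l)),
      (∀ l' ∈ m.primeFactors, ∀ (x : ringClassField K ι m) (x' : ringClassField K ι (m * l)),
        (x : ℂ) = x' → ((d'.σ l' x' : ringClassField K ι (m * l)) : ℂ) = (d.σ l' x : ℂ)) →
      (∀ s ∈ d.S, ∃ s' ∈ d'.S, ∀ (x : ringClassField K ι m) (x' : ringClassField K ι (m * l)),
        (x : ℂ) = x' → ((s' x' : ringClassField K ι (m * l)) : ℂ) = (s x : ℂ)) →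
      (∀ s' ∈ d'.S, ∃ s ∈ d.S, ∀ (x : ringClassField K ι m) (x' : ringClassField K ι (m * l)),
        (x : ℂ) = x' → ((s' x' : ringClassField K ι (m * l)) : ℂ) = (s x : ℂ)) →
      (∀ (x : ringClassField K ι m) (x' : ringClassField K ι (m * l)),
        (x : ℂ) = x' → d'.emb x' = d.emb x) →
    ∀ (v : HeightOneSpectrum (𝓞 K)), (l : 𝓞 K) ∈ v.asIdeal →
    ∀ (j : ℕ),
      (((p ^ j : ℕ) : ℤ) • d'.kolyvaginClass (Fact.out : p.Prime) M ∈
          selmerLocalKer (W.baseChange K) (v.adicCompletion K) ((p ^ M : ℕ) : ℤ) ↔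
        ((p ^ j : ℕ) : ℤ) • d'.kolyvaginClass (Fact.out : p.Prime) M ∈
          (W.baseChange K).torsionLocalKer (v.adicCompletion K) ((p ^ M : ℕ) : ℤ)) ∧
      (((p ^ j : ℕ) : ℤ) • d'.kolyvaginClass (Fact.out : p.Prime) M ∈
          (W.baseChange K).torsionLocalKer (v.adicCompletion K) ((p ^ M : ℕ) : ℤ) ↔
        ((p ^ j : ℕ) : ℤ) • d.kolyvaginClass (Fact.out : p.Prime) M ∈
          (W.baseChange K).torsionLocalKer (v.adicCompletion K) ((p ^ M : ℕ) : ℤ)) := by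
  intro W _ _ _ hcm K _ _ hK hD3 hD4 hH p _ hp2 hsurj Dt β ι M hM m l hsq hl hlm hS d d' hσ hS₁ hS₂
    hemb v hv j
  have hp : p.Prime := Fact.out
  have hD : NumberField.discr K < -4 := KolyvaginAssembly.discr_lt_neg_four hK ⟨hD3, hD4⟩
  have hND : IsCoprime (W.conductorNorm ℤ : ℤ) (NumberField.discr K) :=
    KolyvaginAssembly.isCoprime_discr_of_satisfiesHeegnerHypothesis hK hH
  have hml0 : m * l ≠ 0 := hsq.ne_zero
  have hm0 : m ≠ 0 := fun h ↦ hml0 (by rw [h, zero_mul])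
  have hml : m ∣ m * l := dvd_mul_right m l
  have hsqm : Squarefree m := hsq.squarefree_of_dvd hml
  have hl' : l ∈ (m * l).primeFactors :=
    Nat.mem_primeFactors.mpr ⟨hl, dvd_mul_left l m, hml0⟩
  have hSm : ∀ q ∈ m.primeFactors, Zhang2014.IsKolyvaginPrime (W.conductorNorm ℤ) W K p q ∧
      M ≤ Zhang2014.kolyvaginIndex W p q :=
    fun q hq ↦ hS q (Nat.primeFactors_mono hml hml0 hq)
  have hinert : ∀ (n : ℕ), n ∣ m * l → ∀ q ∈ n.primeFactors, (Ideal.span {(q : 𝓞 K)}).IsPrime :=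
    fun n hn q hq ↦ (hS q (Nat.primeFactors_mono hn hml0 hq)).1.2.2.2.2.1
  have hcop : Nat.Coprime (m * l) (W.conductorNorm ℤ) :=
    coprime_of_primeFactors_inert hH hml0 (hinert (m * l) dvd_rfl)
  -- McCallum's standing input (5): admissibility at both levels, from `ρ̄_{E,p}` onto
  have hA : IsAdmissible (absoluteGaloisGroup K) d.pointsSubgroup ((p ^ M : ℕ) : ℤ) :=
    RingClassNoTorsion.isAdmissible_pointsSubgroup d hK hm0 hp hp2 hsurj M
  have hA' : IsAdmissible (absoluteGaloisGroup K) d'.pointsSubgroup ((p ^ M : ℕ) : ℤ) :=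
    RingClassNoTorsion.isAdmissible_pointsSubgroup d' hK hml0 hp hp2 hsurj M
  -- McCallum's standing input (4): invariance of `[P(·)]` mod `p^M`, for data families through `d`, `d'`
  have hne : ∀ (n : ℕ), n ∣ m * l → Nonempty (KolyvaginHeegnerData Dt β ι n) := fun n hn ↦
    BirchSwinnertonDyer.Theorems.nonempty_kolyvaginHeegnerData_of_grossCM
      (phi_heegnerPointOfConductor_mem_range_map_ringClassField_holds (W.conductorNorm ℤ) W K)
      exists_generator_ringClassGalOver_holds hK hH Dt β ι d.dvd_sq_sub (hsq.squarefree_of_dvd hn)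
      (hinert n hn)
  let data' : (n : ℕ) → n ∣ m * l → KolyvaginHeegnerData Dt β ι n := fun n hn ↦
    if h : n = m * l then h ▸ d' else (hne n hn).some
  have hdata' : data' (m * l) dvd_rfl = d' := by simp [data']
  let data : (n : ℕ) → n ∣ m → KolyvaginHeegnerData Dt β ι n := fun n hn ↦
    if h : n = m then h ▸ d else (hne n (hn.trans hml)).some
  have hdata : data m dvd_rfl = d := by simp [data]
  have hPt' : d'.toGeomPoints d'.derivedPoint ∈
      invPoints (absoluteGaloisGroup K) d'.pointsSubgroup ((p ^ M : ℕ) : ℤ) := by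
    have h := KolyCert.toGeomPoints_derivedPoint_mem_invPoints_of_dvd_zhang hK ι Dt hp hND hD hsq hS
      data' (m * l) dvd_rfl
    rwa [hdata'] at h
  have hPt : d.toGeomPoints d.derivedPoint ∈
      invPoints (absoluteGaloisGroup K) d.pointsSubgroup ((p ^ M : ℕ) : ℤ) := by
    have h := KolyCert.toGeomPoints_derivedPoint_mem_invPoints_of_dvd_zhang hK ι Dt hp hND hD hsqm hSm
      data m dvd_rfl
    rwa [hdata] at h
  -- (γ) for the pair `(mℓ, m)`: the image-free Literature fact, its `ℓ = 2` clause served by surjectivity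
  have hKolG : ∀ q ∈ (m * l).primeFactors,
      Literature.NumberTheory.EllipticCurves.IsKolyvaginPrime (W.conductorNorm ℤ) W K p q :=
    ZhangGross.forall_isKolyvaginPrime_of_zhang W K hK hp2 hsurj fun q hq ↦ (hS q hq).1
  have hmn : m = m * l / l := (Nat.mul_div_cancel m hl.pos).symm
  exact Prop44.localOrder_kolyvaginClass_mul_eq_of_congruence hK hD3 hD4 hH hp2 Dt β ι M hM m l hsq hl
    hlm hS d d' hσ hS₁ hS₂ hemb
    (fun hΔ φ₀ hφ₀ hle γ _ ↦ reductionCongruence_of_eq h372 hK ⟨hD3, hD4⟩ hH hsq hcop hl'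
      (Or.inr ⟨hcm, p, hp, hp2, hsurj, hKolG⟩) (hinert (m * l) dvd_rfl l hl') hmn d' d hΔ hφ₀ hle γ)
    hA hA' hPt hPt' v hv j

end Prop44

/-! ### `h47` in the localisation currency, mod-`p` image -/

/-- **[J] Prop 4.7 (= print Prop 4.4 = [McC] Prop 4.4) in the currency of the abstract Thm 6.3's `h47`**:
under the binders of the typed fact `McCallum1991.prop44_localOrder_kolyvaginClass_mul_eq` (lit-ty,
p478965) — compatible Kolyvagin–Heegner data `d` of conductor `m` and `d'` of conductor `mℓ`, level
`p^M`, the place `λ` of `K` above `ℓ` — the localisations at `λ` of the classes `c_M(mℓ)` and `c_M(m)`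
have THE SAME ORDER: `addOrderOf (loc_λ c_M(mℓ)) = addOrderOf (loc_λ c_M(m))`
(`galoisCohomology.localization`). From the fact's «`p^j c_M(mℓ)_λ = 0 ⟺ p^j c_M(m)_λ = 0`» through the
dictionary `torsionLocalKer = ker loc_λ`. [cite: Jetchev2008, Prop. 4.4 (p. 821) = arXiv Prop. 4.7]
[cite: McCallumLMS1991, §4 Prop. 4.4 (p. 301)] -/
theorem addOrderOf_localization_kolyvaginClass_mul_eq_of_prop44_modP
    (h372 : GrossLMS1991.prop37_2_frobeniusCongruence)
    (W : WeierstrassCurve ℚ) [W.IsElliptic] [W.IsGloballyMinimal] [NeZero (W.conductorNorm ℤ)]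
    (hcm : ¬ W.HasCM) (K : Type) [Field K] [NumberField K] (hK : IsImaginaryQuadratic K)
    (hD3 : NumberField.discr K ≠ -3) (hD4 : NumberField.discr K ≠ -4)
    (hH : SatisfiesHeegnerHypothesis (W.conductorNorm ℤ) K)
    (p : ℕ) [Fact p.Prime] (hp2 : p ≠ 2) (hsurj : W.HasSurjectiveModNGaloisRep p)
    (Dt : ModularParametrizationData W (W.conductorNorm ℤ)) (β : ℤ) (ι : K →+* ℂ)
    (M : ℕ) (hM : 1 ≤ M) (m l : ℕ) (hml : Squarefree (m * l)) (hl : l.Prime) (hlm : ¬ l ∣ m)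
    (hK' : ∀ l' ∈ (m * l).primeFactors, Zhang2014.IsKolyvaginPrime (W.conductorNorm ℤ) W K p l' ∧
      M ≤ Zhang2014.kolyvaginIndex W p l')
    (d : KolyvaginHeegnerData Dt β ι m) (d' : KolyvaginHeegnerData Dt β ι (m * l))
    (hσ : ∀ l' ∈ m.primeFactors, ∀ (x : ringClassField K ι m) (x' : ringClassField K ι (m * l)),
      (x : ℂ) = x' → ((d'.σ l' x' : ringClassField K ι (m * l)) : ℂ) = (d.σ l' x : ℂ))
    (hS : ∀ s ∈ d.S, ∃ s' ∈ d'.S, ∀ (x : ringClassField K ι m) (x' : ringClassField K ι (m * l)),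
      (x : ℂ) = x' → ((s' x' : ringClassField K ι (m * l)) : ℂ) = (s x : ℂ))
    (hS' : ∀ s' ∈ d'.S, ∃ s ∈ d.S, ∀ (x : ringClassField K ι m) (x' : ringClassField K ι (m * l)),
      (x : ℂ) = x' → ((s' x' : ringClassField K ι (m * l)) : ℂ) = (s x : ℂ))
    (hemb : ∀ (x : ringClassField K ι m) (x' : ringClassField K ι (m * l)),
      (x : ℂ) = x' → d'.emb x' = d.emb x)
    (v : HeightOneSpectrum (𝓞 K)) (hv : (l : 𝓞 K) ∈ v.asIdeal) :
    addOrderOf ((galoisCohomology.localization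
        ((W.baseChange K).torsionGaloisModule ((p ^ M : ℕ) : ℤ)) (Sum.inr v) 1 :
          galH1Torsion (W.baseChange K) ((p ^ M : ℕ) : ℤ) →+ _)
        (d'.kolyvaginClass (Fact.out : p.Prime) M)) =
      addOrderOf ((galoisCohomology.localization
        ((W.baseChange K).torsionGaloisModule ((p ^ M : ℕ) : ℤ)) (Sum.inr v) 1 :
          galH1Torsion (W.baseChange K) ((p ^ M : ℕ) : ℤ) →+ _)
        (d.kolyvaginClass (Fact.out : p.Prime) M)) := by
  have hp : p.Prime := Fact.out
  set loc : galH1Torsion (W.baseChange K) ((p ^ M : ℕ) : ℤ) →+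
      galoisCohomology (((W.baseChange K).torsionGaloisModule ((p ^ M : ℕ) : ℤ)).toLocal (Sum.inr v)) 1 :=
    galoisCohomology.localization ((W.baseChange K).torsionGaloisModule ((p ^ M : ℕ) : ℤ)) (Sum.inr v) 1
    with hlocdef
  have hloc : ∀ (z : galH1Torsion (W.baseChange K) ((p ^ M : ℕ) : ℤ)) (j : ℕ), loc (p ^ j • z) = 0 ↔
      ((p ^ j : ℕ) : ℤ) • z ∈ (W.baseChange K).torsionLocalKer (v.adicCompletion K) ((p ^ M : ℕ) : ℤ) := by
    intro z j
    haveI : CharZero (v.adicCompletion K) := charZero_of_injective_algebraMap (algebraMap K _).injective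
    rw [hlocdef, natCast_zsmul, mem_torsionLocalKer_iff_res_eq_zero (W := W.baseChange K)
      (E := v.adicCompletion K) (pow_ne_zero M hp.ne_zero)]
    exact Iff.rfl
  have hkillL : ∀ z : galH1Torsion (W.baseChange K) ((p ^ M : ℕ) : ℤ), p ^ M • loc z = 0 := fun z ↦
    galoisCohomology.nsmul_eq_zero_of_forall
      (((W.baseChange K).torsionGaloisModule ((p ^ M : ℕ) : ℤ)).toLocal (Sum.inr v))
      (fun T ↦ by
        have h := (W.baseChange K).natAbs_nsmul_geomTorsion T
        rwa [Int.natAbs_natCast] at h) (loc z)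
  have h := prop44_of_frobeniusCongruence_modP h372 W hcm K hK hD3 hD4 hH p hp2 hsurj Dt β ι M hM m l hml hl hlm hK' d d' hσ hS hS' hemb v hv
  refine addOrderOf_eq_addOrderOf_of_forall_nsmul_eq_zero_iff hp (hkillL _) (hkillL _) fun j ↦ ?_
  rw [← map_nsmul, ← map_nsmul]
  exact (hloc _ j).trans ((h j).2.trans (hloc _ j).symm)

end Summit.BirchSwinnertonDyer.Rank1Residual.JET

/-! ### The cast form used by the swap walk -/

namespace Summit.BirchSwinnertonDyer.Rank1Residual.JET.Swap

open Summit.BirchSwinnertonDyer.Rank1Residual.JET.GlobalDuality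

variable {K : Type} [Field K] [NumberField K] (W : WeierstrassCurve ℚ) [W.IsElliptic]
  [W.IsGloballyMinimal] [NeZero (W.conductorNorm ℤ)]

/-- **McCallum Prop. 4.4 (localisation currency) with the datum of conductor `mℓ` given at `N = mℓ`**
(bsd-jet's `addOrderOf_localization_kolyvaginClass_mul_eq_of_prop44_modP` through the cast `subst`).
[cite: McCallumLMS1991, §4 Prop. 4.4 (p. 301)] [cite: Jetchev2008, Prop. 4.4 (p. 821)] -/
theorem addOrderOf_localization_kolyvaginClass_eq_of_prop44_cast_modP
    (h372 : GrossLMS1991.prop37_2_frobeniusCongruence)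
    (hcm : ¬ W.HasCM) (hK : IsImaginaryQuadratic K)
    (hD3 : NumberField.discr K ≠ -3) (hD4 : NumberField.discr K ≠ -4)
    (hH : SatisfiesHeegnerHypothesis (W.conductorNorm ℤ) K)
    (p : ℕ) [Fact p.Prime] (hp2 : p ≠ 2) (hsurj : W.HasSurjectiveModNGaloisRep p)
    (Dt : ModularParametrizationData W (W.conductorNorm ℤ)) (β : ℤ) (ι : K →+* ℂ)
    (M : ℕ) (hM : 1 ≤ M) {m l N : ℕ} (hN : m * l = N) (hml : Squarefree N) (hl : l.Prime) (hlm : ¬ l ∣ m)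
    (hK' : ∀ l' ∈ N.primeFactors, Zhang2014.IsKolyvaginPrime (W.conductorNorm ℤ) W K p l' ∧
      M ≤ Zhang2014.kolyvaginIndex W p l')
    (d : KolyvaginHeegnerData Dt β ι m) (d' : KolyvaginHeegnerData Dt β ι N)
    (hσ : ∀ l' ∈ m.primeFactors, ∀ (x : ringClassField K ι m) (x' : ringClassField K ι N),
      (x : ℂ) = x' → ((d'.σ l' x' : ringClassField K ι N) : ℂ) = (d.σ l' x : ℂ))
    (hS : ∀ s ∈ d.S, ∃ s' ∈ d'.S, ∀ (x : ringClassField K ι m) (x' : ringClassField K ι N),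
      (x : ℂ) = x' → ((s' x' : ringClassField K ι N) : ℂ) = (s x : ℂ))
    (hS' : ∀ s' ∈ d'.S, ∃ s ∈ d.S, ∀ (x : ringClassField K ι m) (x' : ringClassField K ι N),
      (x : ℂ) = x' → ((s' x' : ringClassField K ι N) : ℂ) = (s x : ℂ))
    (hemb : ∀ (x : ringClassField K ι m) (x' : ringClassField K ι N), (x : ℂ) = x' → d'.emb x' = d.emb x)
    (v : HeightOneSpectrum (𝓞 K)) (hv : (l : 𝓞 K) ∈ v.asIdeal) :
    addOrderOf ((galoisCohomology.localization
        ((W.baseChange K).torsionGaloisModule ((p ^ M : ℕ) : ℤ)) (Sum.inr v) 1 :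
          galH1Torsion (W.baseChange K) ((p ^ M : ℕ) : ℤ) →+ _)
        (d'.kolyvaginClass (Fact.out : p.Prime) M)) =
      addOrderOf ((galoisCohomology.localization
        ((W.baseChange K).torsionGaloisModule ((p ^ M : ℕ) : ℤ)) (Sum.inr v) 1 :
          galH1Torsion (W.baseChange K) ((p ^ M : ℕ) : ℤ) →+ _)
        (d.kolyvaginClass (Fact.out : p.Prime) M)) := by
  subst hN
  exact addOrderOf_localization_kolyvaginClass_mul_eq_of_prop44_modP h372 W hcm K hK hD3 hD4 hH p hp2 hsurj
    Dt β ι M hM m l hml hl hlm hK' d d' hσ hS hS' hemb v hv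

end Summit.BirchSwinnertonDyer.Rank1Residual.JET.Swap

end
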